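import Mathlib
import Summits.ResolutionOfSingularities.ResolutionOfSingularities.Theorems.RadicialJungCleanModelsLens5TFrameSepBridge
import Literature.FieldTheory.Separability.PDegreeSeparablyGenerated
import HarnessLib

/-!
# Route `RadicialJung`, crux `CleanModels` (stmt-15917): T″ port part 2/10 — §A `[K : k·K^p] = p³` for `K/k` separably generated of transcendence degree 3 (the authors' copy of `Lens5_PDegreeSep.lean`, sub-namespace `PDegreeSep`)

PORT (line lead `res-B-lead-1` g8, for Sketch rev 33) of res-B-lens-5's crux workfiles `Cruxes/DescentPerfectToAll/Lens5_TPrimeInfCurrency.lean` rev 4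
(crux 75ffdaa75b27; author res-B-lens-5 g14), the T″ theorem module prepared by the author from `Lens5_TPrimeInf.lean` rev 3 (HOME
`B/res-B-lens-5/g14/PORTALPHA_TPrimeInf_theorem_module.lean`, sha16 48c5cb0bf6ec7b34, certified by the author's one-file simulation) and
`Cruxes/DescentPerfectToAll/Lens5_TPrimeConst.lean` rev 1 (4e5e6a0028c2): THEOREMS T′_∞ / T″ / T‴ — the slice {`[Γ:pΓ] = p²`, `K/k′` separably
generated and `κ_v/k′` SEPARABLE for some finite intermediate field of constants `k ⊆ k′ ⊆ K`} of the research stub `stub_cleanLU3DefectNonDiscrete`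
(grounds of ARBITRARY, possibly infinite, `p`-rank), modulo F-02 `CossartPiltant2019` and F-32 (`hEmb`) only.  Continues the T⁗-family port
(`…Lens5TFrame{Currency,…,PDegreeC}`): same namespace `Summit.ResolutionOfSingularities.ResolutionOfSingularities.Theorems.RadicialJungCleanModels.Lens5TFrame`,
declarations VERBATIM; the authors' copies of §B/§B′ (defs) and §C/§D (RG/IR lemmas) are NOT repeated — they are the landed `…Lens5TFrameCurrency` /
`…Lens5TFrameRG` / `…Lens5TFrameIR` declarations of the same names and statements; §C′/§B‴ (unused bridges) and the T′_fin/T′₁/«T″ ⊇ T» corollaries are not ported.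
OURS · counted 0 · nothing here proves resolution in characteristic `p`.


-/

set_option linter.dupNamespace false -- mandated namespace of this single-conjunct summit

section

open IsLocalRing
open Literature.AlgebraicGeometry.Resolution
open Summit.ResolutionOfSingularities.ResolutionOfSingularities.Theorems.RadicialJung.CleanModels
open Summit.ResolutionOfSingularities.ResolutionOfSingularities.Theorems.RadicialJung.CleanModels.Lens5
open Summit.ResolutionOfSingularities.ResolutionOfSingularities.Theorems.RadicialJung.CleanModels.Lens5.PRankTwoCurrency
open Summit.ResolutionOfSingularities.ResolutionOfSingularities.Theorems.RadicialJung.CleanModels.Lens5.PRankTwoAssembly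
open Summit.ResolutionOfSingularities.ResolutionOfSingularities.Theorems.RadicialJungCleanModels.Lens5RegularityCriterion
open Summit.ResolutionOfSingularities.ResolutionOfSingularities.Theorems.RadicialJungCleanModels.Lens5ChartSurjection

namespace Summit.ResolutionOfSingularities.ResolutionOfSingularities.Theorems.RadicialJungCleanModels.Lens5TFrame

/-! ## §A `[K : k·K^p] = p³` for `K/k` separably generated of transcendence degree 3 (copy of the crux workfile
`Lens5_PDegreeSep.lean`, ✓ there; crux workfiles are not importable modules, hence the verbatim copy) -/

namespace PDegreeSep

open IntermediateField Module Literature.FieldTheory.Separability Literature.AlgebraicGeometry.Resolution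

variable {k : Type} {K : Type} [Field k] [Field K] [Algebra k K] (p : ℕ) [Fact p.Prime] [CharP K p]

/-- A `k`-derivation of `K` that kills the subfield `F` and the set `t` kills `F(t)`. [folklore] -/
theorem derivation_eq_zero_of_mem_adjoin (F : Subfield K) (hFD : ∀ (D : Derivation k K K) (x : K), x ∈ F → D x = 0)
    (D : Derivation k K K) {t : Set K} (ht : ∀ b ∈ t, D b = 0) {x : K} (hx : x ∈ adjoin F t) : D x = 0 := by
  have hx' : x ∈ Subfield.closure (Set.range (algebraMap F K) ∪ t) := by
    rwa [← adjoin_toSubfield]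
  have h := Derivation.eqOn_subfieldClosure (D₁ := D.restrictScalars ℤ) (D₂ := 0)
    (s := Set.range (algebraMap F K) ∪ t) ?_ hx'
  · simpa using h
  · rintro y (⟨c, rfl⟩ | hy)
    · change D (c : K) = (0 : Derivation ℤ K K) _
      rw [Derivation.zero_apply]
      exact hFD D c c.2
    · change D y = (0 : Derivation ℤ K K) y
      rw [Derivation.zero_apply]
      exact ht y hy

/-- A separating transcendence basis of `K/k` is `p`-independent over any subfield `F ⊇ K^p` killed by all `k`-derivations.
[cite: Matsumura1987, §26 p. 202 and Thm. 26.5] -/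
theorem isPIndependent_of_sepTrBasis (F : Subfield K) (hFp : ∀ x : K, x ^ p ∈ F)
    (hFD : ∀ (D : Derivation k K K) (x : K), x ∈ F → D x = 0) (s : Finset K)
    (hs : AlgebraicIndependent k ((↑) : s → K)) (hsep : Algebra.IsSeparable (adjoin k (s : Set K)) K) :
    IsPIndependent (F := F) p (s : Set K) := by
  classical
  suffices h : ∀ t : Finset K, t ⊆ s → IsPIndependent (F := F) p (t : Set K) from
    fun t ht => (h t (fun x hx => ht hx)) t subset_rfl
  intro t
  induction t using Finset.induction_on with
  | empty =>
    intro _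
    rw [Finset.coe_empty]
    exact isPIndependent_empty _ p
  | insert a t hat ih =>
    intro hts
    have hts' : t ⊆ s := fun x hx => hts (Finset.mem_insert_of_mem hx)
    have has : a ∈ s := hts (Finset.mem_insert_self a t)
    rw [Finset.coe_insert]
    refine isPIndependent_insert (ih hts') ?_ ⟨⟨a ^ p, hFp a⟩, rfl⟩
    intro hmem
    obtain ⟨D, hDa, hDb⟩ := exists_derivation_dual s hs hsep ⟨a, has⟩
    have hDt : ∀ b ∈ (t : Set K), D b = 0 := fun b hb => by
      have hbs : b ∈ s := hts' hb
      have hba : (⟨b, hbs⟩ : s) ≠ ⟨a, has⟩ := fun h => hat (by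
        rw [← show b = a from congrArg Subtype.val h]; exact hb)
      exact hDb ⟨b, hbs⟩ hba
    have := derivation_eq_zero_of_mem_adjoin F hFD D hDt hmem
    rw [hDa] at this
    exact one_ne_zero this

/-- `K = F(s)` for a separating transcendence basis `s` of `K/k` and any subfield `F` containing (the image of) `k` and `K^p`.
[cite: Matsumura1987, §26 p. 202 and Thm. 26.5] -/
theorem adjoin_eq_top_of_sepTrBasis (F : Subfield K) (hFk : ∀ c : k, algebraMap k K c ∈ F) (hFp : ∀ x : K, x ^ p ∈ F)
    (s : Finset K) (hsep : Algebra.IsSeparable (adjoin k (s : Set K)) K) :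
    adjoin F (s : Set K) = ⊤ := by
  classical
  set M : IntermediateField F K := adjoin F (s : Set K) with hM
  have hle : ∀ y : adjoin k (s : Set K), (y : K) ∈ M := by
    intro y
    have hy : (y : K) ∈ Subfield.closure (Set.range (algebraMap k K) ∪ (s : Set K)) := by
      rw [← adjoin_toSubfield]; exact y.2
    have hsub : Set.range (algebraMap k K) ∪ (s : Set K) ⊆ (M.toSubfield : Set K) := by
      rintro z (⟨c, rfl⟩ | hz)
      · exact M.algebraMap_mem ⟨algebraMap k K c, hFk c⟩
      · exact subset_adjoin F (s : Set K) hz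
    exact Subfield.closure_le.mpr hsub hy
  let f : adjoin k (s : Set K) →+* M := (algebraMap (adjoin k (s : Set K)) K).codRestrict M hle
  have hf : (algebraMap M K).comp f = algebraMap (adjoin k (s : Set K)) K := RingHom.ext fun _ => rfl
  haveI : ExpChar M p := by
    haveI : CharP M p := (algebraMap M K).charP (algebraMap M K).injective p
    exact ExpChar.prime Fact.out
  rw [eq_top_iff]
  intro x _
  have hxsep : IsSeparable M x :=
    isSeparable_of_ringHom_comp_eq f hf (Algebra.IsSeparable.isSeparable (adjoin k (s : Set K)) x)
  have hxperf : x ∈ perfectClosure M K := by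
    rw [mem_perfectClosure_iff_pow_mem p]
    refine ⟨1, ⟨⟨x ^ p, M.algebraMap_mem ⟨x ^ p, hFp x⟩⟩, ?_⟩⟩
    rw [pow_one]
    rfl
  have hxbot : x ∈ (⊥ : IntermediateField M K) := by
    rw [← separableClosure_inf_perfectClosure M K]
    exact ⟨mem_separableClosure_iff.mpr hxsep, hxperf⟩
  obtain ⟨y, hy⟩ := IntermediateField.mem_bot.mp hxbot
  rw [← hy]
  exact y.2

/-- `[K : F] = p^{#s}` for a separating transcendence basis `s` of `K/k` and a subfield `F` with `k ⊆ F`, `K^p ⊆ F`, killed by every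
`k`-derivation. [cite: Matsumura1987, §26 p. 202 and Thm. 26.5] -/
theorem finrank_eq_pow_card_of_sepTrBasis (F : Subfield K) (hFk : ∀ c : k, algebraMap k K c ∈ F) (hFp : ∀ x : K, x ^ p ∈ F)
    (hFD : ∀ (D : Derivation k K K) (x : K), x ∈ F → D x = 0) (s : Finset K)
    (hs : AlgebraicIndependent k ((↑) : s → K)) (hsep : Algebra.IsSeparable (adjoin k (s : Set K)) K) :
    finrank F K = p ^ s.card := by
  have h1 := (isPIndependent_of_sepTrBasis p F hFp hFD s hs hsep).finrank_eq s subset_rfl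
  rwa [adjoin_eq_top_of_sepTrBasis p F hFk hFp s hsep, finrank_top'] at h1

/-- `k ⊆ k·K^p`. -/
theorem composite_algebraMap_mem (c : k) :
    algebraMap k K c ∈ Subfield.closure (Set.range (algebraMap k K) ∪ Set.range (frobenius K p)) :=
  Subfield.subset_closure (Or.inl ⟨c, rfl⟩)

/-- `K^p ⊆ k·K^p`. -/
theorem composite_pow_mem (x : K) :
    x ^ p ∈ Subfield.closure (Set.range (algebraMap k K) ∪ Set.range (frobenius K p)) :=
  Subfield.subset_closure (Or.inr ⟨x, frobenius_def ..⟩)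

/-- Every `k`-derivation of `K` kills `k·K^p`. [folklore] -/
theorem composite_derivation_eq_zero (D : Derivation k K K) (x : K)
    (hx : x ∈ Subfield.closure (Set.range (algebraMap k K) ∪ Set.range (frobenius K p))) : D x = 0 := by
  have h := Derivation.eqOn_subfieldClosure (D₁ := D.restrictScalars ℤ) (D₂ := 0)
    (s := Set.range (algebraMap k K) ∪ Set.range (frobenius K p)) ?_ hx
  · simpa using h
  · rintro y (⟨c, rfl⟩ | ⟨z, rfl⟩)
    · change D (algebraMap k K c) = (0 : Derivation ℤ K K) _
      rw [Derivation.zero_apply, Derivation.map_algebraMap]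
    · change D (frobenius K p z) = (0 : Derivation ℤ K K) _
      rw [Derivation.zero_apply, frobenius_def]
      exact Derivation.apply_pow_char (p := p) (D.restrictScalars ℤ) z

/-- `[K : k·K^p] = p^{#s}` for a finite separating transcendence basis `s` of `K/k`, ANY ground field `k` of characteristic `p`.
[cite: Matsumura1987, §26 p. 202 and Thm. 26.5] -/
theorem finrank_composite_eq_pow_card (s : Finset K) (hs : AlgebraicIndependent k ((↑) : s → K))
    (hsep : Algebra.IsSeparable (adjoin k (s : Set K)) K) :
    finrank (Subfield.closure (Set.range (algebraMap k K) ∪ Set.range (frobenius K p))) K = p ^ s.card :=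
  finrank_eq_pow_card_of_sepTrBasis p _ (composite_algebraMap_mem p) (composite_pow_mem p)
    (composite_derivation_eq_zero p) s hs hsep

omit [CharP K p] in
/-- `[K : k·K^p] = p³` for `K = Frac A`, `A` a finitely generated `k`-algebra of Krull dimension `3` over ANY field `k` of
characteristic `p`, `K/k` separably generated. [cite: Matsumura1987, Thm. 26.5] -/
theorem pDegreeThreeOfSepGenerated :
    ∀ (k : Type) [Field k] [CharP k p] (K : Type) [Field K] [Algebra k K] [CharP K p] (A : Subalgebra k K),
      A.FG → IsFractionRing A K → ringKrullDim A = 3 →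
        (∃ (n : ℕ) (s : Fin n → K), AlgebraicIndependent k s ∧ Algebra.IsSeparable (IntermediateField.adjoin k (Set.range s)) K) →
        Module.finrank (Subfield.closure (Set.range (algebraMap k K) ∪ Set.range (frobenius K p))) K = p ^ 3 := by
  intro k _ _ K _ _ _ A hAfg hfrac hdim hsg
  classical
  obtain ⟨n, s, hs, hsep⟩ := hsg
  haveI : Algebra.FiniteType k A := A.fg_iff_finiteType.mp hAfg
  haveI : Algebra.EssFiniteType A K := Algebra.EssFiniteType.of_isLocalization K (nonZeroDivisors A)
  haveI : Algebra.EssFiniteType k K := Algebra.EssFiniteType.comp k A K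
  obtain ⟨d, hd, htr⟩ := Literature.RingTheory.KrullDimension.exists_ringKrullDim_eq_and_trdeg_eq k A
  have hd3 : d = 3 := by
    rw [hd] at hdim
    exact_mod_cast hdim
  haveI : FaithfulSMul k A := (faithfulSMul_iff_algebraMap_injective k A).mpr (algebraMap k A).injective
  haveI : FaithfulSMul A K := (faithfulSMul_iff_algebraMap_injective A K).mpr (IsFractionRing.injective A K)
  haveI : Algebra.IsAlgebraic A K := IsLocalization.isAlgebraic K (nonZeroDivisors A)
  have htrK : Algebra.trdeg k K = (3 : ℕ) := by
    rw [← trdeg_add_eq k A (A := K), trdeg_eq_zero (R := A) (A := K), add_zero, htr, hd3]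
  haveI := hsep
  have halg : Algebra.IsAlgebraic (IntermediateField.adjoin k (Set.range s)) K := inferInstance
  have htb : IsTranscendenceBasis k s :=
    hs.isTranscendenceBasis_iff_isAlgebraic.mpr (IntermediateField.isAlgebraic_adjoin_iff_top.mp halg)
  have hn : n = 3 := by
    have h := htb.cardinalMk_eq_trdeg
    rw [Cardinal.mk_fin, htrK] at h
    exact_mod_cast h
  set s' : Finset K := Finset.univ.image s with hs'
  have hcoe : (s' : Set K) = Set.range s := by
    rw [hs', Finset.coe_image, Finset.coe_univ, Set.image_univ]
  have hs'' : AlgebraicIndependent k ((↑) : s' → K) := by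
    have := hs.to_subtype_range' hcoe.symm
    exact this
  have hsep' : Algebra.IsSeparable (adjoin k (s' : Set K)) K := by
    rw [hcoe]; exact hsep
  have hcard : s'.card = 3 := by
    rw [hs', Finset.card_image_of_injective _ hs.injective, Finset.card_univ, Fintype.card_fin, hn]
  rw [finrank_composite_eq_pow_card p s' hs'' hsep', hcard]

end PDegreeSep

end Summit.ResolutionOfSingularities.ResolutionOfSingularities.Theorems.RadicialJungCleanModels.Lens5TFrame

end
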